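import Literature.Analysis.FluidPDE.ForwardDSSExistenceBT1Reduction
import Literature.Analysis.FluidPDE.PeriodicLerayMollifiedAssembly
import HarnessLib

/-!
# Discharges of named facts of `PeriodicLeraySystem.lean`

`Literature/Analysis/FluidPDE/PeriodicLeraySystemHolds.lean` — proofs-only sibling of
`PeriodicLeraySystem.lean` (no definitions, no named facts). Each theorem below closes a named
fact `X : Prop` of that file as `X_holds : X` by composing an ACCEPTED reduction theorem of
the tree with the ACCEPTED unconditional `_holds` discharges of all of its hypotheses; nothing
is re-proved and no statement is changed. Recorded by the librarian sweep g25 (2026-08-16,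
pass 5c: facts dischargeable in one line from the tree's own lemmas), so that the facts
census, `#h21_route_deps` and the cone guardrail see these facts as theorems.

Discharged here:

* `bradshawTsai2017_thm_2_4_periodic_holds` :=
  `bradshawTsai2017_thm_2_4_periodic_of_mollified` `bradshawTsai2017_thm_2_4_mollified_holds`
  (`ForwardDSSExistenceBT1Reduction.lean`).

## References

* [BradshawTsai2017AHP] — see `lean/references.bib` and the docstring of the fact in `PeriodicLeraySystem.lean`.
-/

namespace Literature.Analysis.FluidPDE

/-- **Discharge of the named fact `bradshawTsai2017_thm_2_4_periodic`**
(`PeriodicLeraySystem.lean`): [BT1] Theorem 2.4 (Existence of suitable periodic weak solutions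
to (2.1)), in its own (similarity) variables: "Assume `U₀(y,s)` satisfies Assumption 2.1 with
`q = 10/3`. … — obtained as `bradshawTsai2017_thm_2_4_periodic_of_mollified` applied to the
tree's unconditional discharge `bradshawTsai2017_thm_2_4_mollified_holds` of its hypothesis
(reduction in `ForwardDSSExistenceBT1Reduction.lean`).
[cite: BradshawTsai2017AHP, Thm 2.4 and its proof] -/
theorem bradshawTsai2017_thm_2_4_periodic_holds :
    bradshawTsai2017_thm_2_4_periodic :=
  bradshawTsai2017_thm_2_4_periodic_of_mollified bradshawTsai2017_thm_2_4_mollified_holds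

end Literature.Analysis.FluidPDE
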